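import Mathlib
import HarnessLib
import Literature.Analysis.ValidatedNumerics.MultiPrecisionInterval
import Summits.HubbardSuperconductivity.HubbardSuperconductivity.Theorems.KLProgrammeFreeBandJetExpr

/-!
# Route `KLProgramme` — ENGINE crux `KLRegimeEngineV17F2` (stmt-HubbardSuperconductivity-20437), row (C) `stub_twoLeg_curvature`,
# producer hypothesis `hcertA : KlwjCertA` — KLWJ-INKERNEL part 2a: THE KERNEL-EXECUTABLE BOX CHECKER (definitions)
# (cell gate-hubbard-kl, seat hubbard-kl-k3c5-p1 g21; docket «KLWJ-INKERNEL-ROUTE» (p1b g19 memo 5340b98f1348eb46); 0 kit)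

Sequel of `…FreeBandJetExpr` (jet expressions `JE`, the formal curve derivation `Dc`).  The twelve derivative entries of the
polar-jet table `klwjTableA` (`…PerturbedFermiCurveWindowJetsDefs`) bound `|⟦Dc^[k] e⟧(θ, t)|` (`e = atom 2, E01, atom 2 / W`,
`k = 1 … 4`; part 1b) over the region `{(θ, t) : θ ∈ [0, π/4], F(θ, t) ∈ [a, b]}`.  This file defines — computably, so that the
kernel can run it by `decide` — the checker that certifies such bounds on a (θ, t)-BOX, in the tree's fixed-point interval
arithmetic `NumericsMP.MI` (`Literature/Analysis/ValidatedNumerics/MultiPrecisionInterval`, scale `S`, every operation with an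
inclusion theorem):
* §1 register files as BRAUN TREES (`Regs`, `O(log n)` access — the jet terms are evaluated as one straight-line program with
  sharing, 482 instructions for the fifteen quantities of the table instead of 7·10⁵ tree nodes) and straight-line programs
  `List Ins` run over an arbitrary interpretation `Alg α` of the six constructors of `JE` (`Alg.run`): the FREE interpretation
  `treeAlg` (registers hold `JE` terms — used once, by `decide`, to identify the program's outputs with the terms `Dc^[k] e` of
  part 1), the REAL interpretation `realAlg A` and the INTERVAL interpretation `ivAlg S As W` (registers hold `Option MI`);
* §2 the enclosure of `(cos x, sin x)` for `x` in an interval `X ⊆ [0, π]` from the tree's point enclosures `MC.expI` at the two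
  endpoints and monotonicity (`trigEncl`), the seven atom intervals of a box `[θ₀, θ₁] × [t₀, t₁]` (`boxAtoms`), the radial-slope
  interval `W`;
* §3 the leaf checks (`checkLeaf`: all thirteen `|·| ≤` table rows on the box; `skipLeaf`: the level `F = -2(cos(t cos θ) + cos(t sin θ))`
  misses the window `[a, b]` on the box) and the CERTIFICATE TREE `Cert` (binary subdivision of the root box at dyadic midpoints,
  recomputed exactly in `ℚ`) with its checker `checkCert`.
The soundness theorems are part 2b (`…FreeBandJetCheckSound`); the certificate data and the `decide` runs are part 3.
Pure definitions; nothing here asserts any table entry, row (C), any stub of 20437, K3, U₀, the window, a margin or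
superconductivity in the Hubbard model.
References: R. E. Moore, *Interval Analysis* (1966), Ch. 3–4 (inclusion isotonicity, bisection) [folklore]; W. Braun, M. Rem,
*A logarithmic implementation of flexible arrays* (1983) (Braun trees) [folklore]; G. Melquiond, *Proving bounds on real-valued
functions with computations*, IJCAR 2008, §3.3 (straight-line programs over a generic interpretation) [folklore].
-/

namespace Summit.HubbardSuperconductivity.HubbardSuperconductivity.Theorems.FreeBandJets

set_option linter.dupNamespace false -- summit = problem name (single-conjunct summit), D-0017

open Literature.Analysis.ValidatedNumerics.NumericsMP

/-! ## §1 Register files, straight-line programs, interpretations -/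

/-- A register file as a Braun tree (index `0` at the root, odd indices left, even indices right). -/
inductive Regs (α : Type) : Type
  /-- empty -/
  | nil : Regs α
  /-- a node -/
  | node (x : α) (l r : Regs α) : Regs α

namespace Regs

variable {α : Type}

/-- Read register `i` (default `d` if absent). -/
def getD (d : α) : Regs α → ℕ → α
  | nil, _ => d
  | node x l r, i => if i = 0 then x else if i % 2 = 1 then getD d l (i / 2) else getD d r (i / 2 - 1)

/-- Append a value at index `n`, where `n` is the current number of registers. -/
def push : Regs α → ℕ → α → Regs α
  | nil, _, x => node x nil nil
  | node y l r, n, x => if n % 2 = 1 then node y (push l (n / 2) x) r else node y l (push r (n / 2 - 1) x)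

end Regs

/-- One instruction of a straight-line program: a constructor of `JE` with register operands. -/
inductive Ins : Type
  /-- push the `i`-th atom -/
  | atom (i : ℕ) : Ins
  /-- push the constant `z` -/
  | const (z : ℤ) : Ins
  /-- push `r_a + r_b` -/
  | add (a b : ℕ) : Ins
  /-- push `r_a · r_b` -/
  | mul (a b : ℕ) : Ins
  /-- push `-r_a` -/
  | neg (a : ℕ) : Ins
  /-- push `r_a / Wⁿ` -/
  | divW (a : ℕ) (n : ℕ) : Ins
  deriving DecidableEq, Inhabited, Repr

/-- An interpretation of the six constructors in a carrier `α`, with a default value for absent registers. -/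
structure Alg (α : Type) : Type where
  /-- the atoms -/
  atom : ℕ → α
  /-- the constants -/
  const : ℤ → α
  /-- sum -/
  add : α → α → α
  /-- product -/
  mul : α → α → α
  /-- negation -/
  neg : α → α
  /-- division by `Wⁿ` -/
  divW : α → ℕ → α
  /-- default register value -/
  dflt : α

namespace Alg

variable {α : Type} (G : Alg α)

/-- Execute one instruction against the register file. -/
def exec (regs : Regs α) : Ins → α
  | Ins.atom i => G.atom i
  | Ins.const z => G.const z
  | Ins.add a b => G.add (regs.getD G.dflt a) (regs.getD G.dflt b)
  | Ins.mul a b => G.mul (regs.getD G.dflt a) (regs.getD G.dflt b)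
  | Ins.neg a => G.neg (regs.getD G.dflt a)
  | Ins.divW a n => G.divW (regs.getD G.dflt a) n

/-- Run a program: instruction `n` pushes register `n`. -/
def run : List Ins → Regs α → ℕ → Regs α
  | [], regs, _ => regs
  | ins :: p, regs, n => run p (regs.push n (G.exec regs ins)) (n + 1)

/-- The register file after running the whole program from the empty file. -/
def runAll (p : List Ins) : Regs α := G.run p Regs.nil 0

/-- Output register `r` of the program. -/
def out (p : List Ins) (r : ℕ) : α := (G.runAll p).getD G.dflt r

end Alg

/-- The FREE interpretation: registers hold jet expressions. -/
def treeAlg : Alg JE := ⟨JE.atom, JE.const, JE.add, JE.mul, JE.neg, JE.divW, JE.const 0⟩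

/-- The REAL interpretation under an atom assignment `A` (`W = JE.wval A`). -/
noncomputable def realAlg (A : ℕ → ℝ) : Alg ℝ :=
  ⟨A, fun z => (z : ℝ), (· + ·), (· * ·), fun x => -x, fun x n => x / JE.wval A ^ n, 0⟩

/-- `n`-fold interval division by `W` (fails unless `0 < W.lo`). -/
def divWI (S : ℕ) (W : MI) : Option MI → ℕ → Option MI
  | o, 0 => o
  | o, n + 1 => (divWI S W o n).bind fun I => MI.divPos S I W

/-- The INTERVAL interpretation at scale `S` with atom intervals `As` and radial-slope interval `W` (`none` = no enclosure). -/
def ivAlg (S : ℕ) (As : ℕ → MI) (W : MI) : Alg (Option MI) :=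
  ⟨fun i => some (As i), fun z => some (MI.ofInt S z),
    fun x y => x.bind fun I => y.bind fun J => some (I.add J),
    fun x y => x.bind fun I => y.bind fun J => some (I.mul S J),
    fun x => x.bind fun I => some I.neg,
    fun x n => divWI S W x n, none⟩

/-! ## §2 Trigonometric enclosures and the atoms of a box -/

/-- Parameters of the interval evaluation: scale `S`, `expI` Taylor order `K` and halvings `k`, an enclosure `piI ∋ π`. -/
structure Prm : Type where
  /-- the fixed-point scale -/
  S : ℕ
  /-- Taylor terms of `MC.expI` -/
  K : ℕ
  /-- argument halvings of `MC.expI` -/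
  k : ℕ
  /-- an enclosure of `π` at scale `S` -/
  piI : MI

/-- The interval `[⌊lo·S⌋, ⌈hi·S⌉]` of a rational interval `[lo, hi]`. -/
def ivOfRat (S : ℕ) (lo hi : ℚ) : MI := ⟨Rat.floor (lo * S), -Rat.floor (-hi * S)⟩

/-- Upper endpoint of the sine enclosure over `X ⊆ [0, π]` from the endpoint boxes `eL ∋ e^{i lo}`, `eH ∋ e^{i hi}`:
`sin hi` if `X ⊆ [0, π/2]`, `sin lo` if `X ⊆ [π/2, π]`, else `1`. -/
def sinUpper (P : Prm) (X : MI) (eL eH : MC) : ℤ :=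
  if 2 * X.hi ≤ P.piI.lo then eH.im.hi else if P.piI.hi ≤ 2 * X.lo then eL.im.hi else (P.S : ℤ)

/-- Enclosures `(C, Sn)` of `cos` and `sin` over an interval `X ⊆ [0, π]` (checked): the point enclosures `MC.expI` of `e^{ix}` at
the two endpoints, hulled by the monotonicity of `cos` on `[0, π]` and of `sin` on `[0, π/2]`, `[π/2, π]`. -/
def trigEncl (P : Prm) (X : MI) : Option (MI × MI) :=
  if 0 ≤ X.lo ∧ X.hi ≤ P.piI.lo then
    (MC.expI P.S P.K P.k P.piI (MI.lower X)).bind fun eL =>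
      (MC.expI P.S P.K P.k P.piI (MI.upper X)).bind fun eH =>
        some (⟨eH.re.lo, eL.re.hi⟩, ⟨min eL.im.lo eH.im.lo, sinUpper P X eL eH⟩)
  else none

/-- The seven atom intervals of a box. -/
structure Atoms7 : Type where
  /-- `cos θ` -/
  c : MI
  /-- `sin θ` -/
  s : MI
  /-- `t` -/
  t : MI
  /-- `sin(t cos θ)` -/
  s1 : MI
  /-- `cos(t cos θ)` -/
  c1 : MI
  /-- `sin(t sin θ)` -/
  s2 : MI
  /-- `cos(t sin θ)` -/
  c2 : MI

namespace Atoms7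

/-- As an atom assignment (`0` beyond index `6`). -/
def toFun (S : ℕ) (at7 : Atoms7) : ℕ → MI
  | 0 => at7.c
  | 1 => at7.s
  | 2 => at7.t
  | 3 => at7.s1
  | 4 => at7.c1
  | 5 => at7.s2
  | 6 => at7.c2
  | _ => MI.ofInt S 0

/-- The radial-slope interval `W = 2(c·s1 + s·s2)`. -/
def W (S : ℕ) (at7 : Atoms7) : MI := ((at7.c.mul S at7.s1).add (at7.s.mul S at7.s2)).mulInt 2

/-- The level interval `F = -2(c1 + c2)`. -/
def F (at7 : Atoms7) : MI := (at7.c1.add at7.c2).mulInt (-2)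

end Atoms7

/-- The atom intervals of the box `[θ₀, θ₁] × [t₀, t₁]` (`none` if a trigonometric argument is not certified inside `[0, π]`). -/
def boxAtoms (P : Prm) (th0 th1 t0 t1 : ℚ) : Option Atoms7 :=
  (trigEncl P (ivOfRat P.S th0 th1)).bind fun cs =>
    (trigEncl P ((ivOfRat P.S t0 t1).mul P.S cs.1)).bind fun e1 =>
      (trigEncl P ((ivOfRat P.S t0 t1).mul P.S cs.2)).bind fun e2 =>
        some ⟨cs.1, cs.2, ivOfRat P.S t0 t1, e1.2, e1.1, e2.2, e2.1⟩

/-! ## §3 Leaf checks and the certificate tree -/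

/-- The output registers of the fifteen quantities of the polar-jet table in a program. -/
structure Regix : Type where
  /-- `F` -/
  rF : ℕ
  /-- `W = ∂_tF` -/
  rD0 : ℕ
  /-- `u'` … `u⁗` -/
  rR1 : ℕ
  /-- `u″` -/
  rR2 : ℕ
  /-- `u‴` -/
  rR3 : ℕ
  /-- `u⁗` -/
  rR4 : ℕ
  /-- `D'` … `D⁗` -/
  rD1 : ℕ
  /-- `D″` -/
  rD2 : ℕ
  /-- `D‴` -/
  rD3 : ℕ
  /-- `D⁗` -/
  rD4 : ℕ
  /-- `J` … `J⁗` -/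
  rG0 : ℕ
  /-- `J'` -/
  rG1 : ℕ
  /-- `J″` -/
  rG2 : ℕ
  /-- `J‴` -/
  rG3 : ℕ
  /-- `J⁗` -/
  rG4 : ℕ

/-- The thirteen bounds checked on a box (rationals): `|u^{(k)}| ≤ R_k`, `|D^{(k)}| ≤ D_k` (`k = 1 … 4`), `|J^{(k)}| ≤ G_k` (`k = 0 … 4`). -/
structure Tab : Type where
  /-- `|u′| ≤ R1` -/
  R1 : ℚ
  /-- `|u″| ≤ R2` -/
  R2 : ℚ
  /-- `|u‴| ≤ R3` -/
  R3 : ℚ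
  /-- `|u⁗| ≤ R4` -/
  R4 : ℚ
  /-- `|D′| ≤ D1` -/
  D1 : ℚ
  /-- `|D″| ≤ D2` -/
  D2 : ℚ
  /-- `|D‴| ≤ D3` -/
  D3 : ℚ
  /-- `|D⁗| ≤ D4` -/
  D4 : ℚ
  /-- `|J| ≤ G0` -/
  G0 : ℚ
  /-- `|J′| ≤ G1` -/
  G1 : ℚ
  /-- `|J″| ≤ G2` -/
  G2 : ℚ
  /-- `|J‴| ≤ G3` -/
  G3 : ℚ
  /-- `|J⁗| ≤ G4` -/
  G4 : ℚ

/-- `|x| ≤ B` is certified for every real `x` in the register's interval: `absHi · den B ≤ num B · S`. -/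
def bddAbs (S : ℕ) (o : Option MI) (B : ℚ) : Bool :=
  match o with
  | some I => decide (I.absHi * (B.den : ℤ) ≤ B.num * (S : ℤ))
  | none => false

/-- The thirteen table rows hold on the whole box: run the program in interval arithmetic and compare. -/
def checkLeaf (P : Prm) (prog : List Ins) (ix : Regix) (tab : Tab) (th0 th1 t0 t1 : ℚ) : Bool :=
  match boxAtoms P th0 th1 t0 t1 with
  | none => false
  | some at7 =>
      let W := at7.W P.S
      let G := ivAlg P.S (at7.toFun P.S) W
      let regs := G.runAll prog
      let o : ℕ → Option MI := fun r => regs.getD none r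
      decide (0 < W.lo) &&
        bddAbs P.S (o ix.rR1) tab.R1 && bddAbs P.S (o ix.rR2) tab.R2 && bddAbs P.S (o ix.rR3) tab.R3 && bddAbs P.S (o ix.rR4) tab.R4 &&
        bddAbs P.S (o ix.rD1) tab.D1 && bddAbs P.S (o ix.rD2) tab.D2 && bddAbs P.S (o ix.rD3) tab.D3 && bddAbs P.S (o ix.rD4) tab.D4 &&
        bddAbs P.S (o ix.rG0) tab.G0 && bddAbs P.S (o ix.rG1) tab.G1 && bddAbs P.S (o ix.rG2) tab.G2 && bddAbs P.S (o ix.rG3) tab.G3 &&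
        bddAbs P.S (o ix.rG4) tab.G4

/-- The level `F` misses the window `[a, b]` on the whole box (`F < a` or `F > b` there). -/
def skipLeaf (P : Prm) (a b : ℚ) (th0 th1 t0 t1 : ℚ) : Bool :=
  match boxAtoms P th0 th1 t0 t1 with
  | none => false
  | some at7 =>
      let F := at7.F
      decide (F.hi * (a.den : ℤ) < a.num * (P.S : ℤ)) || decide (b.num * (P.S : ℤ) < F.lo * (b.den : ℤ))

/-- A certificate: a binary subdivision tree of the root box (`splitH` halves the angle, `splitV` the radius; leaves are checked by
`checkLeaf` resp. `skipLeaf`). -/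
inductive Cert : Type
  /-- a box on which the table rows are checked -/
  | ok : Cert
  /-- a box outside the level window -/
  | skip : Cert
  /-- halve `[θ₀, θ₁]` -/
  | splitH (l r : Cert) : Cert
  /-- halve `[t₀, t₁]` -/
  | splitV (l r : Cert) : Cert
  deriving Inhabited, Repr

/-- **The certificate checker** on the box `[θ₀, θ₁] × [t₀, t₁]`. -/
def checkCert (P : Prm) (prog : List Ins) (ix : Regix) (tab : Tab) (a b : ℚ) : ℚ → ℚ → ℚ → ℚ → Cert → Bool
  | th0, th1, t0, t1, Cert.ok => checkLeaf P prog ix tab th0 th1 t0 t1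
  | th0, th1, t0, t1, Cert.skip => skipLeaf P a b th0 th1 t0 t1
  | th0, th1, t0, t1, Cert.splitH l r =>
      checkCert P prog ix tab a b th0 ((th0 + th1) / 2) t0 t1 l && checkCert P prog ix tab a b ((th0 + th1) / 2) th1 t0 t1 r
  | th0, th1, t0, t1, Cert.splitV l r =>
      checkCert P prog ix tab a b th0 th1 t0 ((t0 + t1) / 2) l && checkCert P prog ix tab a b th0 th1 ((t0 + t1) / 2) t1 r

/-- Number of leaves of a certificate. -/
def Cert.leaves : Cert → ℕ
  | ok => 1
  | skip => 1
  | splitH l r => l.leaves + r.leaves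
  | splitV l r => l.leaves + r.leaves

end Summit.HubbardSuperconductivity.HubbardSuperconductivity.Theorems.FreeBandJets
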